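import Summits.BirchSwinnertonDyer.BirchSwinnertonDyer.Theorems.GoldfeldAllTwistsTwoConverseTwinQuarterTraceRedei
import HarnessLib

set_option linter.dupNamespace false -- namespace `…BirchSwinnertonDyer.BirchSwinnertonDyer…` is the cell's (D-0017 nested layout)
set_option autoImplicit false

/-!
# Cell C7 (β, `q ≡ 7 (mod 8)`, `p ≡ 1 (mod 8)`, `(p/q) = −1`), file F3 = (K7): Rédei rank ONE at `d_K = −8qp` —
# `#(Cl² ∩ Cl[2]) = 2`, `8 ∣ h(−8qp)`, and `κ = #Cl(𝒪_{d_K})²` is EVEN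

Cell `bsd-goldfeld`, seat `bsd-goldfeld-s1p-c3x` (gen 12); planner RULING (cccxxxviii) (TRANCHE C7-2, pre-authorised), memo `HOME/C7-HORIZON.md` §2 (K7) /
§4 F3. `--supports stmt-BirchSwinnertonDyer-20044` as a HELPER. Theses-free; theorems only; no definition, no `sorry`, no named fact: FACT-FREE (the
tree's Rédei–Reichardt theorem `redeiReichardt_fourTwoCard_classGroup_holds` is PROVED; this file evaluates its `3 × 3` certificate on `(2, q, p)`).

OBJECT (the flipped bit (K7) of the C7 line; file R = `…TwinQuarterTraceRedei` is the C6/C8 companion with `r₄ = 0`). For primes `q ≡ 7 (mod 8)`,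
`p ≡ 1 (mod 8)` with `(p/q) = −1`, `n = 2qp ≡ 6 (mod 8)`, `D = −8qp = 8·(−q)·p`: the Rédei matrix on `(2, q, p)` is `[[0,0,0],[0,1,1],[0,1,1]]`
(`(−q/2) = (p/2) = +1` as `−q ≡ p ≡ 1 (mod 8)`; `(8/q) = (8/p) = +1`; `(p/q) = (−q/p) = −1`) of rank `1`: kernel of order `4 = 2^{1+1}`, so
`r₄ = 1` — **`#(Cl_F² ∩ Cl_F[2]) = 2`** for every quadratic `F ∋ √−2qp` (`fourTwoCard_eq_two_negEightTwoPrimes_pOne`, the tree's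
`fourTwoCard_eq_two_of_card_ker'`); with Gauss's `#Cl_F[2] = 4` (`t = 3`) and §1 (`#G = #G[2]·#G²`, `G²` has an element of order `2`):
**`8 ∣ h`**, and on the tree's abstract-order carrier (Cox 7.7 (ii) by cardinality, file R §2) with `#Cl = 4·κ` (`…TwinQuarterTraceTorsion`):
**`κ = #Cl(𝒪_{d_K})²` is EVEN** (`even_natCard_range_sq_negEightTwoPrimes_pOne`) — the hypothesis `hκ` of the C7 closer F6
(`heegnerNonTorsion_negEightTwoPrimes_betaPOne`; `κ` even and `m` even cancel in `Odd (κ − 1 − 0 − m·1)`).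

NUMERICS (kit j312848 + j313281, 70 C7 rows with qp ≤ 150000): `h(−8qp) ≡ 0 (mod 8)` on 70/70 (`≡ 0 / 8 (mod 16)`: 35/35), `2`-part of `Cl` with
`(r₂, r₄, r₈) = (2,1,0)` or `(2,1,1)` (35/35). HONEST FRAMING: class-group arithmetic only; BSD is not proved by any of this.

References: [LiMa2008] Lemma 0.1, Def. 0.2, Thm. 0.4; [Stevenhagen1995RedeiMatrices] §2; [RedeiReichardt1934]; [Cox2013] §3.A Prop. 3.11, §5.B, §7.B Thm. 7.7 (ii);
[IrelandRosen1990] Ch. 5 §2 Thm. 2.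
-/

noncomputable section

open Matrix NumberField
open Literature.NumberTheory Literature.NumberTheory.EllipticCurves
open Literature.NumberTheory.EllipticCurves.Tian2014 (IsQuadraticFieldOfSqrt fourTwoCard fourTwoCard_def)
open Literature.NumberTheory.QuadraticFields.RedeiReichardt
open Literature.NumberTheory.EllipticCurves.LiLiuTian2024.RedeiFamilies (natCast_ne_zero_of_prime_ne kroneckerBit_eq_zero_iff_jacobiSym
  kroneckerBit_two_of_mod_eight_one)
open Literature.Computability.Cryptography.Hallgren2005

namespace Summit.BirchSwinnertonDyer.BirchSwinnertonDyer.Theorems.GoldfeldGoodTwists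

/-! ## §1 Group theory: `#G[2] = 2^a`, `#(G² ∩ G[2]) = 2` ⟹ `2^{a+1} ∣ #G` -/

/-- **`#G[2] = 2^a` and `#(G² ∩ G[2]) = 2` imply `2^{a+1} ∣ #G`** (finite abelian `G`): `#G = #G[2]·#G²` and `G²` contains an element of order `2`
(the non-trivial square killed by `2`), so `2 ∣ #G²` — «`r₄ = 1` ⟹ `2^t ∣ h`». [cite: LiMa2008, Thm. 0.4 and the remark after it (p. 280)] -/
theorem pow_succ_dvd_natCard_of_fourTwoCard_eq_two {G : Type*} [CommGroup G] [Finite G] {a : ℕ}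
    (h2 : Nat.card {c : G // c ^ 2 = 1} = 2 ^ a) (h4 : fourTwoCard G = 2) : 2 ^ (a + 1) ∣ Nat.card G := by
  classical
  set f : G →* G := powMonoidHom 2 with hf
  have hker : Nat.card f.ker = 2 ^ a := by
    rw [← h2]
    exact Nat.card_congr (Equiv.subtypeEquivRight fun c => by rw [MonoidHom.mem_ker, hf, powMonoidHom_apply])
  rw [fourTwoCard_def] at h4
  have hnt : Nontrivial {x : G // IsSquare x ∧ x ^ 2 = 1} := Finite.one_lt_card_iff_nontrivial.mp (by rw [h4]; norm_num)
  obtain ⟨⟨g, ⟨y, hy⟩, hg1⟩, hne⟩ := exists_ne (⟨1, IsSquare.one, one_pow 2⟩ : {x : G // IsSquare x ∧ x ^ 2 = 1})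
  have hg : g ≠ 1 := fun h ↦ hne (Subtype.ext h)
  have hgr : g ∈ f.range := ⟨y, by rw [hf, powMonoidHom_apply, sq, hy]⟩
  have horder : orderOf (⟨g, hgr⟩ : f.range) = 2 := by
    refine orderOf_eq_prime ?_ ?_
    · exact Subtype.ext (by simpa using hg1)
    · exact fun h ↦ hg (congrArg Subtype.val h)
  have h2r : 2 ∣ Nat.card f.range := by rw [← horder]; exact orderOf_dvd_natCard _
  have hmul : Nat.card f.ker * Nat.card f.range = Nat.card G := by
    rw [← Subgroup.index_ker, Subgroup.card_mul_index]
  rw [← hmul, hker, pow_succ]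
  exact Nat.mul_dvd_mul_left _ h2r

/-! ## §2 Rédei–Reichardt at `n = 2qp`, `D = −8qp` (`q ≡ 7 (mod 8)`, `p ≡ 1 (mod 8)`, `(p/q) = −1`): rank one -/
section EightTwoPrimes
variable {q p : ℕ}

/-- `(8/r) = +1` for a prime `r ≡ ±1 (mod 8)`: `(8/r) = (2/r)³ = χ₈(r)³`. [cite: IrelandRosen1990, Ch. 5 §1 (supplement (2/p))] -/
theorem jacobiSym_eight_eq_one {r : ℕ} (hr : r % 8 = 1 ∨ r % 8 = 7) : jacobiSym 8 r = 1 := by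
  have h2 : jacobiSym 2 r = 1 := by
    rw [jacobiSym.at_two (Nat.odd_iff.mpr (by omega)), ZMod.χ₈_nat_eq_if_mod_eight]
    have h0 : r % 2 ≠ 0 := by omega
    simp [h0, hr]
  rw [show (8 : ℤ) = 2 * (2 * 2) by norm_num, jacobiSym.mul_left, jacobiSym.mul_left, h2]; norm_num

/-- **`RM(−8qp) = [[0,0,0],[0,1,1],[0,1,1]]`** on the tuple `(2, q, p)` when `q ≡ 7 (mod 8)`, `p ≡ 1 (mod 8)`, `(p/q) = −1`: `D₂ = 8`, `D_q = −q`, `D_p = p`;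
`(−q/2) = (p/2) = +1` (Kronecker: `−q ≡ p ≡ 1 (mod 8)`), `(8/q) = (8/p) = +1`, `(p/q) = −1`, `(−q/p) = (q/p) = (p/q) = −1`; diagonal = row sums.
[cite: LiMa2008, Def. 0.2 and Thm. 0.4 (pp. 279–280); evaluation ours] [cite: IrelandRosen1990, Ch. 5 §2 Thm. 2 (reciprocity)] -/
theorem redeiMatrix_negEightTwoPrimes_pOne (hq : q.Prime) (hp : p.Prime) (hq8 : q % 8 = 7) (hp8 : p % 8 = 1)
    (hpq : jacobiSym (p : ℤ) q = -1) : redeiMatrix (2 * q * p) ![2, q, p] = !![0, 0, 0; 0, 1, 1; 0, 1, 1] := by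
  have hq2 : q ≠ 2 := by omega
  have hp2 : p ≠ 2 := by omega
  have hne : q ≠ p := by omega
  have hn8 : 2 * q * p % 8 = 6 := by
    rw [Nat.mul_mod, Nat.mul_mod 2 q, hq8, hp8]
  have d2 : primeDisc (2 * q * p) 2 = 8 := by
    have h4 : ¬ (2 * q * p % 4 = 1) := by omega
    simp [primeDisc, h4, hn8]
  have dq : primeDisc (2 * q * p) q = -(q : ℤ) := by rw [primeDisc_of_ne_two _ hq2, if_neg (by omega)]
  have dp : primeDisc (2 * q * p) p = p := by rw [primeDisc_of_ne_two _ hp2, if_pos (by omega)]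
  -- the six off-diagonal bits
  have e01 : kroneckerBit (-(q : ℤ)) 2 = 0 := by rw [kroneckerBit_two, if_neg (by omega)]
  have e02 : kroneckerBit (p : ℤ) 2 = 0 := kroneckerBit_two_of_mod_eight_one hp8
  haveI : Fact q.Prime := ⟨hq⟩
  haveI : Fact p.Prime := ⟨hp⟩
  have h8q : ((8 : ℤ) : ZMod q) ≠ 0 := by
    have h := natCast_ne_zero_of_prime_ne hq Nat.prime_two hq2.symm
    intro h0; apply h
    have : ((8 : ℤ) : ZMod q) = ((2 : ℤ) : ZMod q) ^ 3 := by push_cast; norm_num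
    rw [this] at h0
    exact pow_eq_zero_iff (by norm_num) |>.mp h0
  have h8p : ((8 : ℤ) : ZMod p) ≠ 0 := by
    have h := natCast_ne_zero_of_prime_ne hp Nat.prime_two hp2.symm
    intro h0; apply h
    have : ((8 : ℤ) : ZMod p) = ((2 : ℤ) : ZMod p) ^ 3 := by push_cast; norm_num
    rw [this] at h0
    exact pow_eq_zero_iff (by norm_num) |>.mp h0
  have e10 : kroneckerBit 8 q = 0 := (kroneckerBit_eq_zero_iff_jacobiSym hq hq2 h8q).mpr (jacobiSym_eight_eq_one (Or.inr hq8))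
  have e20 : kroneckerBit 8 p = 0 := (kroneckerBit_eq_zero_iff_jacobiSym hp hp2 h8p).mpr (jacobiSym_eight_eq_one (Or.inl hp8))
  have e12 : kroneckerBit (p : ℤ) q = 1 :=
    (kroneckerBit_eq_one_iff_jacobiSym hq hq2 (natCast_ne_zero_of_prime_ne hq hp hne.symm)).mpr hpq
  have hqp : jacobiSym (-(q : ℤ)) p = -1 := by
    rw [jacobiSym.neg _ (Nat.odd_iff.mpr (by omega)), ZMod.χ₄_nat_one_mod_four (by omega), one_mul,
      ← jacobiSym.quadratic_reciprocity_one_mod_four (by omega) (Nat.odd_iff.mpr (by omega))]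
    exact hpq
  have e21 : kroneckerBit (-(q : ℤ)) p = 1 := by
    refine (kroneckerBit_eq_one_iff_jacobiSym hp hp2 ?_).mpr hqp
    rw [Int.cast_neg, neg_ne_zero]
    exact natCast_ne_zero_of_prime_ne hp hq hne
  ext i j
  fin_cases i <;> fin_cases j <;>
    simp [redeiMatrix, Finset.sum_erase_eq_sub, Fin.sum_univ_three, d2, dq, dp, e01, e02, e10, e20, e12, e21]

/-- Kernel count `4` (`rank RM = 1`, `r₄ = 1`) for `D = −8qp` on C7. [cite: LiMa2008, Thm. 0.4 (p. 280)] -/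
theorem card_ker_redeiMatrix_negEightTwoPrimes_pOne (hq : q.Prime) (hp : p.Prime) (hq8 : q % 8 = 7) (hp8 : p % 8 = 1)
    (hpq : jacobiSym (p : ℤ) q = -1) :
    Fintype.card {v : Fin 3 → ZMod 2 // redeiMatrix (2 * q * p) ![2, q, p] *ᵥ v = 0} = 4 := by
  have hM := redeiMatrix_negEightTwoPrimes_pOne hq hp hq8 hp8 hpq
  rw [Fintype.card_congr (Equiv.subtypeEquivRight
    (q := fun v : Fin 3 → ZMod 2 => (!![0, 0, 0; 0, 1, 1; 0, 1, 1] : Matrix (Fin 3) (Fin 3) (ZMod 2)) *ᵥ v = 0)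
    (fun v => by rw [hM]))]
  decide

/-- The side conditions of the Rédei door for the tuple `(2, q, p)`: primes, injective, `∏ = 2qp = n` (`n ≡ 2 (mod 4)`). [cite: LiMa2008, Lemma 0.1 (p. 279)] -/
theorem redei_side_conditions_negEightTwoPrimes_pOne (hq : q.Prime) (hp : p.Prime) (hq8 : q % 8 = 7) (hp8 : p % 8 = 1) :
    (∀ i, ((![2, q, p] : Fin 3 → ℕ) i).Prime) ∧ Function.Injective (![2, q, p] : Fin 3 → ℕ) ∧
      (∏ i, (![2, q, p] : Fin 3 → ℕ) i) = if (2 * q * p) % 4 = 1 then 2 * (2 * q * p) else 2 * q * p := by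
  have hn8 : 2 * q * p % 8 = 6 := by rw [Nat.mul_mod, Nat.mul_mod 2 q, hq8, hp8]
  have h4 : 2 * q * p % 4 ≠ 1 := by omega
  refine ⟨?_, ?_, ?_⟩
  · intro i; fin_cases i
    · exact Nat.prime_two
    · exact hq
    · exact hp
  · intro i j h
    have hq2 : q ≠ 2 := by omega
    have hp2 : p ≠ 2 := by omega
    have hne : q ≠ p := by omega
    fin_cases i <;> fin_cases j <;> simp_all
  · rw [if_neg h4, Fin.prod_univ_three]
    simp [mul_assoc]

/-- **`(p/q) = −1`, `q ≡ 7`, `p ≡ 1 (mod 8)` ⟹ `#(Cl² ∩ Cl[2]) = 2` for every quadratic `F ∋ √−2qp`** (`r₄ = 1`).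
[cite: LiMa2008, Thm. 0.4 (p. 280); evaluation ours] -/
theorem fourTwoCard_eq_two_negEightTwoPrimes_pOne (hq : q.Prime) (hp : p.Prime) (hq8 : q % 8 = 7) (hp8 : p % 8 = 1)
    (hpq : jacobiSym (p : ℤ) q = -1) (F : Type) [Field F] [NumberField F]
    (hF : IsQuadraticFieldOfSqrt F (-((2 * q * p : ℕ) : ℤ))) : fourTwoCard (ClassGroup (𝓞 F)) = 2 := by
  obtain ⟨hpr, hinj, hprod⟩ := redei_side_conditions_negEightTwoPrimes_pOne hq hp hq8 hp8
  exact fourTwoCard_eq_two_of_card_ker' hpr hinj hprod (card_ker_redeiMatrix_negEightTwoPrimes_pOne hq hp hq8 hp8 hpq) F hF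

end EightTwoPrimes

/-! ## §3 `8 ∣ h(−8qp)` and `κ = #Cl(𝒪_{d_K})²` even on C7 -/
section EvenKappa
variable {K : Type} [Field K] [NumberField K]

/-- **`8 ∣ #Cl(𝒪_{d_K})` for `d_K = −8qp` on C7** (`q ≡ 7`, `p ≡ 1 (mod 8)` primes, `(p/q) = −1`): `#Cl(𝒪_{d_K}) = #Cl(𝓞_K)` (file R §2),
`#Cl_K[2] = 4` (Gauss, `t = 3`), `#(Cl_K² ∩ Cl_K[2]) = 2` (§2). [cite: LiMa2008, Thm. 0.4] [cite: Cox2013, §3.A Prop. 3.11 and §7.B Thm. 7.7 (ii)] -/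
theorem eight_dvd_natCard_classGroup_QO_negEightTwoPrimes_pOne (hK : IsImaginaryQuadratic K) {q p : ℕ} (hq : q.Prime)
    (hp : p.Prime) (hq8 : q % 8 = 7) (hp8 : p % 8 = 1) (hpq : jacobiSym (p : ℤ) q = -1)
    (hdK : NumberField.discr K = -(8 * (q : ℤ) * p)) : 8 ∣ Nat.card (ClassGroup (OrderCl.QO hK.negDiscr)) := by
  classical
  have hne : q ≠ p := by omega
  rw [natCard_classGroup_QO_negDiscr_eq hK]
  have hK' : IsQuadraticFieldOfSqrt K (-((2 * q * p : ℕ) : ℤ)) :=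
    isQuadraticFieldOfSqrt_of_discr_eq_four_mul hK (by rw [hdK]; push_cast; ring)
  have h42 := fourTwoCard_eq_two_negEightTwoPrimes_pOne hq hp hq8 hp8 hpq K hK'
  have h2tor : Nat.card {c : ClassGroup (𝓞 K) // c ^ 2 = 1} = 2 ^ 2 := by
    rw [natCard_sq_eq_one_classGroup_of_primeFactors hK (S := {2, q, p}) ?_]
    · rw [Finset.card_insert_of_notMem (by simp; omega), Finset.card_insert_of_notMem (by simp [hne]), Finset.card_singleton]
    · rw [hdK, show (-(8 * (q : ℤ) * p)) = -((2 ^ 3 * (q * p) : ℕ) : ℤ) by push_cast; ring, Int.natAbs_neg, Int.natAbs_natCast,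
        Nat.primeFactors_mul (by positivity) (Nat.mul_ne_zero hq.ne_zero hp.ne_zero),
        Nat.primeFactors_prime_pow (by norm_num) Nat.prime_two, Nat.primeFactors_mul hq.ne_zero hp.ne_zero, hq.primeFactors,
        hp.primeFactors]
      rfl
  have h := pow_succ_dvd_natCard_of_fourTwoCard_eq_two h2tor h42
  rwa [show (2 : ℕ) ^ (2 + 1) = 8 by norm_num] at h

/-- **`κ = #Cl(𝒪_{d_K})²` is EVEN for `d_K = −8qp` on C7** (`q ≡ 7`, `p ≡ 1 (mod 8)`, `(p/q) = −1`): `#Cl = 4·κ` (`…TwinQuarterTraceTorsion`) and `8 ∣ #Cl`.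
The hypothesis `hκ` of the C7 closer `heegnerNonTorsion_negEightTwoPrimes_betaPOne`. [cite: LiMa2008, Thm. 0.4] [cite: Cox2013, §3.A Prop. 3.11] -/
theorem even_natCard_range_sq_negEightTwoPrimes_pOne (hK : IsImaginaryQuadratic K) {q p : ℕ} (hq : q.Prime) (hp : p.Prime)
    (hq8 : q % 8 = 7) (hp8 : p % 8 = 1) (hpq : jacobiSym (p : ℤ) q = -1) (hdK : NumberField.discr K = -(8 * (q : ℤ) * p)) :
    Even (Nat.card (powMonoidHom 2 : ClassGroup (OrderCl.QO hK.negDiscr) →* ClassGroup (OrderCl.QO hK.negDiscr)).range) := by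
  classical
  haveI : Finite (ClassGroup (OrderCl.QO hK.negDiscr)) := Nat.finite_of_card_ne_zero (by
    rw [natCard_classGroup_QO_negDiscr_eq hK]; exact (Nat.card_pos (α := ClassGroup (𝓞 K))).ne')
  have hΔ : hK.negDiscr.D = -(8 * (q : ℤ) * p) := by rw [hK.negDiscr_D, hdK]
  have h8 := eight_dvd_natCard_classGroup_QO_negEightTwoPrimes_pOne hK hq hp hq8 hp8 hpq hdK
  rw [natCard_eq_four_mul_natCard_range_sq_negEightTwoPrimes hK.negDiscr hq hp (by omega) (by omega) (by omega) hΔ] at h8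
  obtain ⟨k, hk⟩ := h8
  exact ⟨k, by omega⟩

end EvenKappa

end Summit.BirchSwinnertonDyer.BirchSwinnertonDyer.Theorems.GoldfeldGoodTwists

end
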